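import Literature.Topology.FourManifolds.TautFoliationsGermCovering
import Literature.Topology.FourManifolds.TautFoliationsTameFunctions
import Mathlib.Analysis.Normed.Module.Convex
import Mathlib.Topology.MetricSpace.Pseudo.Lemmas
import HarnessLib

/-!
# Good sub-boxes of a flow box: automatic compatibility with every box containing them

Sibling of `TautFoliationsPlaques.lean` (compatibility of the foliated atlas: the transverse
coordinate of one box is locally constant along the plaques of another) and
`TautFoliationsHolonomyCocycle.lean` (height transitions are locally strictly monotone, and
increasing for a transversely oriented atlas). For a `C⁰` codimension-one foliation
`F : Literature.Topology.FourManifolds.Foliation B M` with leaf model a real normed space `B`, a **sub-box**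
of a flow box `e` is the image `e.symm '' ball p₀ ρ` of a ball of the box `B × ℝ` (max norm: a
product `ball b₀ ρ ×ˢ ball t₀ ρ` of a ball of `B` and an interval). The point of this file is
that **a sub-box is compatible with every flow box `e'` of the atlas whose source contains it,
globally on the sub-box and with no further shrinking** (`IsTransverselyOriented.exists_transitionOn`):
the `e'`-height is a continuous strictly increasing function `γ` of the `e`-height on the whole
sub-box. Indeed the horizontal slices `e.symm (ball b₀ ρ × {t})` are connected pieces of
plaques of `e` inside `e'.source`, on which the `e'`-height is constant
(`height_eq_of_isPreconnected`), so `h_{e'} = γ ∘ h_e` with `γ t = h_{e'} (e.symm (b₀, t))`;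
`γ` is continuous, locally strictly increasing by the transverse orientation, hence strictly
increasing on the interval `ball t₀ ρ` (`strictMonoOn_of_forall_exists_nhds`, a local-to-global
lemma proved here by the Lebesgue number lemma).

This is the device that makes the `C⁰` general position of a disc uniform (Camacho–Lins Neto,
*Geometric Theory of Foliations*, Ch. VI §3, Prop. 1, proof: the pieces `U_i ⊆ V_i ⊆ W_i` of
the disc are mapped into single foliation boxes, and the distinguished maps of overlapping
boxes are compared on the overlaps): images of small squares are kept inside sub-boxes, and
all comparisons of heights between the boxes of neighbouring squares are then exact.

* `Foliation.subbox e p₀ ρ` (**definition**) and its elementary properties (open, inside the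
  source, membership read in the box, existence inside any neighbourhood, stability under
  convex combinations read in the box).
* `strictMonoOn_of_forall_exists_nhds` (**proved**): a real function locally strictly
  increasing at every point of an order-connected set is strictly increasing on it.
* `IsTransverselyOriented.exists_transitionOn` (**proved**): the global increasing transition
  `γ` on a sub-box contained in `e'.source`; corollaries `height_lt_iff_of_subbox`,
  `height_eq_iff_of_subbox` (order and equality of heights agree in `e` and `e'` on the
  sub-box) and **tameness of the height along a curve in a sub-box does not depend on the
  box** (`IsTameOn.height_of_subbox`, with `TautFoliationsTameFunctions.lean`).

## References

* C. Camacho, A. Lins Neto, *Geometric Theory of Foliations*, Birkhäuser (1985), Ch. VI §3,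
  Prop. 1 [CamachoLinsNeto1985].
* G. Hector, U. Hirsch, *Introduction to the Geometry of Foliations, Part A* (1986), Ch. II
  2.1.6 (iii), Def. 2.2.8 [HectorHirsch1986].

## Design notes

* `B` is a real normed space (balls are convex, hence connected); `B × ℝ` carries the max
  norm, so `ball (b₀, t₀) ρ = ball b₀ ρ ×ˢ ball t₀ ρ` (`ball_prod_same`).
-/
open Set Filter Metric Topology

namespace Literature.Topology.FourManifolds

/-! ## Local-to-global strict monotonicity -/

/-- **A locally strictly increasing function is strictly increasing** on an order-connected set
of reals: if every point of `I` has a neighbourhood `U` with `f` strictly increasing on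
`U ∩ I`, then `f` is strictly increasing on `I`. For `s < t` in `I`, a Lebesgue number of the
cover of `[s, t]` by these neighbourhoods gives a uniform partition of `[s, t]` each step of
which lies in one of them, and the inequalities chain. [folklore] -/
theorem strictMonoOn_of_forall_exists_nhds {f : ℝ → ℝ} {I : Set ℝ} (hI : I.OrdConnected)
    (h : ∀ t ∈ I, ∃ U ∈ 𝓝 t, StrictMonoOn f (U ∩ I)) : StrictMonoOn f I := by
  intro s hs t ht hst
  have hsub : Icc s t ⊆ I := hI.out hs ht
  choose! U hU hmono using h
  -- Lebesgue number of the cover of `[s, t]` by the interiors of the `U x`, `x ∈ [s, t]`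
  obtain ⟨δ, hδ, hball⟩ := lebesgue_number_lemma_of_metric (ι := Icc s t) isCompact_Icc
    (c := fun x ↦ interior (U x)) (fun _ ↦ isOpen_interior)
    fun x hx ↦ mem_iUnion.2 ⟨⟨x, hx⟩, mem_interior_iff_mem_nhds.2 (hU x (hsub hx))⟩
  -- a uniform partition of mesh `< δ`
  obtain ⟨m, hm⟩ := exists_nat_gt ((t - s) / δ)
  have hm₀ : 0 < (m : ℝ) := lt_of_le_of_lt (div_nonneg (by linarith) hδ.le) hm
  set μ : ℝ := (t - s) / m with hμ
  have hμ₀ : 0 < μ := div_pos (by linarith) hm₀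
  have hμδ : μ < δ := by
    rw [hμ, div_lt_iff₀ hm₀]
    calc t - s = (t - s) / δ * δ := by field_simp
      _ < m * δ := mul_lt_mul_of_pos_right hm hδ
      _ = δ * m := mul_comm _ _
  set u : ℕ → ℝ := fun k ↦ s + k * μ with hu
  have hu₀ : u 0 = s := by simp [hu]
  have husucc : ∀ k, u (k + 1) = u k + μ := fun k ↦ by simp only [hu]; push_cast; ring
  have hum : u m = t := by
    simp only [hu, hμ]
    field_simp
    ring
  have hus : ∀ k, s ≤ u k := fun k ↦ by
    simp only [hu]
    nlinarith [hμ₀.le, (Nat.cast_nonneg k : (0 : ℝ) ≤ k)]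
  have hut : ∀ k, k ≤ m → u k ≤ t := fun k hk ↦ by
    rw [← hum]
    simp only [hu]
    have : (k : ℝ) ≤ m := by exact_mod_cast hk
    nlinarith [hμ₀.le]
  -- one step of the partition stays in one neighbourhood
  have hstep : ∀ k, k < m → f (u k) < f (u (k + 1)) := by
    intro k hk
    have hk₁ : u k ∈ Icc s t := ⟨hus k, hut k hk.le⟩
    have hk₂ : u (k + 1) ∈ Icc s t := ⟨hus (k + 1), hut (k + 1) hk⟩
    obtain ⟨⟨x, hx⟩, hxU⟩ := hball (u k) hk₁
    have h₁ : u k ∈ U x := interior_subset (hxU (mem_ball_self hδ))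
    have h₂ : u (k + 1) ∈ U x := by
      refine interior_subset (hxU ?_)
      rw [mem_ball, Real.dist_eq, husucc, add_sub_cancel_left, abs_of_pos hμ₀]
      exact hμδ
    exact hmono x (hsub hx) ⟨h₁, hsub hk₁⟩ ⟨h₂, hsub hk₂⟩ (by rw [husucc]; linarith)
  -- chain the inequalities
  have hchain : ∀ k, k ≤ m → 1 ≤ k → f s < f (u k) := by
    intro k
    induction k with
    | zero => intro _ h; exact absurd h (by norm_num)
    | succ k ih =>
      intro hk _
      rcases Nat.eq_zero_or_pos k with rfl | hkpos
      · rw [← hu₀]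
        exact hstep 0 (by omega)
      · exact (ih (Nat.le_of_succ_le hk) hkpos).trans (hstep k (Nat.lt_of_succ_le hk))
  have hm₁ : 1 ≤ m := by
    by_contra h0
    push Not at h0
    have : m = 0 := by omega
    rw [this] at hm₀
    simp at hm₀
  have := hchain m le_rfl hm₁
  rwa [hum] at this

namespace Foliation

variable {B : Type*} [NormedAddCommGroup B] {M : Type*} [TopologicalSpace M]
variable {e e' : OpenPartialHomeomorph M (B × ℝ)} {p₀ : B × ℝ} {ρ : ℝ} {z u v : M}
variable (F : Foliation B M)

-- BODY
/-! ## Sub-boxes -/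

/-- The **sub-box** of the flow box `e` over the ball of centre `p₀` and radius `ρ` of the box
`B × ℝ` (max norm, so a product `ball b₀ ρ × (t₀ - ρ, t₀ + ρ)`): its image under `e.symm`.
[folklore] -/
def subbox (e : OpenPartialHomeomorph M (B × ℝ)) (p₀ : B × ℝ) (ρ : ℝ) : Set M := e.symm '' ball p₀ ρ

/-- A sub-box lies in the source of its flow box. [folklore] -/
theorem subbox_subset_source (he : e ∈ F.atlas) : subbox e p₀ ρ ⊆ e.source := by
  rintro _ ⟨p, -, rfl⟩
  exact e.map_target (by rw [F.target_eq e he]; exact mem_univ _)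

/-- **Membership in a sub-box, read in the box**: `u ∈ subbox e p₀ ρ` iff `u ∈ e.source` and
`e u ∈ ball p₀ ρ`. [folklore] -/
theorem mem_subbox_iff (he : e ∈ F.atlas) : u ∈ subbox e p₀ ρ ↔ u ∈ e.source ∧ e u ∈ ball p₀ ρ := by
  constructor
  · rintro ⟨p, hp, rfl⟩
    have hpt : p ∈ e.target := by rw [F.target_eq e he]; exact mem_univ _
    exact ⟨e.map_target hpt, by rwa [e.right_inv hpt]⟩
  · rintro ⟨hu, hup⟩
    exact ⟨e u, hup, e.left_inv hu⟩

/-- The box coordinates of a point of a sub-box lie in the ball. [folklore] -/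
theorem apply_mem_ball_of_mem_subbox (he : e ∈ F.atlas) (hu : u ∈ subbox e p₀ ρ) : e u ∈ ball p₀ ρ :=
  ((F.mem_subbox_iff he).1 hu).2

/-- The height of a point of a sub-box lies in the height interval `ball p₀.2 ρ`. [folklore] -/
theorem height_mem_ball_of_mem_subbox (he : e ∈ F.atlas) (hu : u ∈ subbox e p₀ ρ) :
    height e u ∈ ball p₀.2 ρ := by
  have h := F.apply_mem_ball_of_mem_subbox he hu
  rw [← Prod.mk.eta (p := p₀), ← ball_prod_same] at h
  exact h.2

/-- The `B`-coordinate of a point of a sub-box lies in the ball `ball p₀.1 ρ`. [folklore] -/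
theorem fst_mem_ball_of_mem_subbox (he : e ∈ F.atlas) (hu : u ∈ subbox e p₀ ρ) :
    (e u).1 ∈ ball p₀.1 ρ := by
  have h := F.apply_mem_ball_of_mem_subbox he hu
  rw [← Prod.mk.eta (p := p₀), ← ball_prod_same] at h
  exact h.1

/-- `e.symm` of a point of the ball lies in the sub-box. [folklore] -/
theorem symm_mem_subbox {p : B × ℝ} (hp : p ∈ ball p₀ ρ) : e.symm p ∈ subbox e p₀ ρ :=
  mem_image_of_mem _ hp

/-- A sub-box is open. [folklore] -/
theorem isOpen_subbox (he : e ∈ F.atlas) : IsOpen (subbox e p₀ ρ) := by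
  have : subbox e p₀ ρ = e.source ∩ e ⁻¹' ball p₀ ρ := by
    ext u
    rw [F.mem_subbox_iff he]
    rfl
  rw [this]
  exact e.continuousOn.isOpen_inter_preimage e.open_source isOpen_ball

/-- The centre point: `z ∈ subbox e (e z) ρ` for `z ∈ e.source` and `ρ > 0`. [folklore] -/
theorem mem_subbox_self (he : e ∈ F.atlas) (hz : z ∈ e.source) (hρ : 0 < ρ) : z ∈ subbox e (e z) ρ :=
  (F.mem_subbox_iff he).2 ⟨hz, mem_ball_self hρ⟩

/-- **Sub-boxes form a neighbourhood basis**: every neighbourhood of a point `z` of a flow box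
contains a sub-box centred at `e z`. [folklore] -/
theorem exists_subbox_subset (he : e ∈ F.atlas) (hz : z ∈ e.source) {O : Set M} (hO : O ∈ 𝓝 z) :
    ∃ ρ > (0 : ℝ), subbox e (e z) ρ ⊆ O := by
  have hc : ContinuousAt e.symm (e z) := (F.continuous_symm_of_mem he).continuousAt
  have hO' : e.symm ⁻¹' O ∈ 𝓝 (e z) := hc.preimage_mem_nhds (by rwa [e.left_inv hz])
  obtain ⟨ρ, hρ, hball⟩ := Metric.mem_nhds_iff.1 hO'
  exact ⟨ρ, hρ, by rintro _ ⟨p, hp, rfl⟩; exact hball hp⟩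

/-! ## Horizontal slices of a sub-box are connected plaque pieces -/

/-- The horizontal slice of a sub-box at height `t`: the image of `ball p₀.1 ρ × {t}`.
[folklore] -/
theorem symm_mk_mem_subbox {b : B} {t : ℝ} (hb : b ∈ ball p₀.1 ρ) (ht : t ∈ ball p₀.2 ρ) :
    e.symm (b, t) ∈ subbox e p₀ ρ := by
  refine symm_mem_subbox ?_
  rw [← Prod.mk.eta (p := p₀), ← ball_prod_same]
  exact ⟨hb, ht⟩

/-- The horizontal slice at height `t` lies on the plaque of `e` at height `t`. [folklore] -/
theorem slice_subset_plaque (he : e ∈ F.atlas) (t : ℝ) :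
    (fun b : B ↦ e.symm (b, t)) '' ball p₀.1 ρ ⊆ plaque e t := by
  rintro _ ⟨b, -, rfl⟩
  exact F.symm_mem_plaque he b t

variable [NormedSpace ℝ B]

/-- **Sub-boxes are convex in the box**: `e.symm` of a convex combination of the box
coordinates of two points of the ball lies in the sub-box. [folklore] -/
theorem symm_combo_mem_subbox {p q : B × ℝ} (hp : p ∈ ball p₀ ρ) (hq : q ∈ ball p₀ ρ) {a b : ℝ}
    (ha : 0 ≤ a) (hb : 0 ≤ b) (hab : a + b = 1) : e.symm (a • p + b • q) ∈ subbox e p₀ ρ :=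
  symm_mem_subbox (convex_ball p₀ ρ hp hq ha hb hab)

/-- The horizontal slice of a sub-box at height `t` is preconnected (the continuous image of a
ball of `B`). [folklore] -/
theorem isPreconnected_slice (he : e ∈ F.atlas) (t : ℝ) :
    IsPreconnected ((fun b : B ↦ e.symm (b, t)) '' ball p₀.1 ρ) :=
  (convex_ball p₀.1 ρ).isPreconnected.image _
    ((F.continuous_symm_of_mem he).comp (continuous_id.prodMk continuous_const)).continuousOn

/-! ## The global transition on a sub-box -/

/-- The candidate transition: the `e'`-height along the vertical of `e` through the centre.
[folklore] -/
theorem height_eq_height_symm_of_mem_subbox (he : e ∈ F.atlas) (he' : e' ∈ F.atlas)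
    (hsub : subbox e p₀ ρ ⊆ e'.source) (hu : u ∈ subbox e p₀ ρ) :
    height e' u = height e' (e.symm (p₀.1, height e u)) := by
  -- `u` and `e.symm (p₀.1, h_e u)` lie on the same horizontal slice
  have hu' := (F.mem_subbox_iff he).1 hu
  have ht : height e u ∈ ball p₀.2 ρ := F.height_mem_ball_of_mem_subbox he hu
  have hb : (e u).1 ∈ ball p₀.1 ρ := F.fst_mem_ball_of_mem_subbox he hu
  have hρ : 0 < ρ := lt_of_le_of_lt dist_nonneg (mem_ball.1 ht)
  have huslice : u ∈ (fun b : B ↦ e.symm (b, height e u)) '' ball p₀.1 ρ := by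
    refine ⟨(e u).1, hb, ?_⟩
    show e.symm ((e u).1, (e u).2) = u
    rw [Prod.mk.eta, e.left_inv hu'.1]
  have hcslice : e.symm (p₀.1, height e u) ∈ (fun b : B ↦ e.symm (b, height e u)) '' ball p₀.1 ρ :=
    ⟨p₀.1, mem_ball_self hρ, rfl⟩
  have hslice_sub : (fun b : B ↦ e.symm (b, height e u)) '' ball p₀.1 ρ ⊆ e'.source := by
    rintro _ ⟨b, hb', rfl⟩
    exact hsub (symm_mk_mem_subbox hb' ht)
  exact F.height_eq_of_isPreconnected he he' (F.isPreconnected_slice he _)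
    (F.slice_subset_plaque he _) hslice_sub huslice hcslice

variable {F} in
/-- **Global compatibility of a sub-box with every box containing it.** For a transversely
oriented atlas, a sub-box `subbox e p₀ ρ` of a flow box `e`, and a flow box `e'` of the atlas
with `subbox e p₀ ρ ⊆ e'.source`, there is a function `γ`, continuous and strictly increasing on
the height interval `ball p₀.2 ρ`, with `h_{e'} = γ ∘ h_e` on the whole sub-box: the changes
of transverse coordinate between the two boxes are exact on the sub-box, with no shrinking
(Hector–Hirsch A, Ch. II 2.1.6 (iii) and Def. 2.2.8 (i), globalised along connected plaque
pieces). [cite: HectorHirsch1986, Ch. II Def. 2.2.8] -/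
theorem IsTransverselyOriented.exists_transitionOn (ho : F.IsTransverselyOriented) (he : e ∈ F.atlas)
    (he' : e' ∈ F.atlas) (hsub : subbox e p₀ ρ ⊆ e'.source) :
    ∃ γ : ℝ → ℝ, ContinuousOn γ (ball p₀.2 ρ) ∧ StrictMonoOn γ (ball p₀.2 ρ) ∧
      ∀ u ∈ subbox e p₀ ρ, height e' u = γ (height e u) := by
  set γ : ℝ → ℝ := fun t ↦ height e' (e.symm (p₀.1, t)) with hγ
  refine ⟨γ, ?_, ?_, fun u hu ↦ F.height_eq_height_symm_of_mem_subbox he he' hsub hu⟩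
  · -- continuity: the vertical runs in the sub-box, inside `e'.source`
    intro t ht
    have hmem : e.symm (p₀.1, t) ∈ e'.source := hsub (symm_mk_mem_subbox (mem_ball_self
      (lt_of_le_of_lt dist_nonneg (mem_ball.1 ht))) ht)
    have h1 : ContinuousAt (fun τ : ℝ ↦ e.symm (p₀.1, τ)) t :=
      ((F.continuous_symm_of_mem he).comp (continuous_const.prodMk continuous_id)).continuousAt
    exact ((continuousAt_height hmem).comp_of_eq h1 rfl).continuousWithinAt
  · -- local strict monotonicity from the transverse orientation, globalised
    refine strictMonoOn_of_forall_exists_nhds (by rw [Real.ball_eq_Ioo]; exact ordConnected_Ioo)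
      fun t ht ↦ ?_
    have hρ : 0 < ρ := lt_of_le_of_lt dist_nonneg (mem_ball.1 ht)
    set zt : M := e.symm (p₀.1, t) with hzt
    have hzt_e : zt ∈ e.source := F.subbox_subset_source he (symm_mk_mem_subbox (mem_ball_self hρ) ht)
    have hzt_e' : zt ∈ e'.source := hsub (symm_mk_mem_subbox (mem_ball_self hρ) ht)
    obtain ⟨U, hU, hUo⟩ := ho e he e' he' zt ⟨hzt_e, hzt_e'⟩
    -- the vertical through the centre is continuous and passes through `zt` at `t`
    have hc : ContinuousAt (fun τ : ℝ ↦ e.symm (p₀.1, τ)) t :=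
      ((F.continuous_symm_of_mem he).comp (continuous_const.prodMk continuous_id)).continuousAt
    have hev : ∀ᶠ τ in 𝓝 t, e.symm (p₀.1, τ) ∈ U ∩ (e.source ∩ e'.source) := by
      refine hc.preimage_mem_nhds (inter_mem hU (inter_mem (e.open_source.mem_nhds hzt_e)
        (e'.open_source.mem_nhds hzt_e')))
    refine ⟨{τ | e.symm (p₀.1, τ) ∈ U ∩ (e.source ∩ e'.source)}, hev, ?_⟩
    rintro τ₁ ⟨h₁, -⟩ τ₂ ⟨h₂, -⟩ hlt
    have key := hUo _ h₁ _ h₂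
    have e₁ : (e (e.symm (p₀.1, τ₁))).2 = τ₁ := by
      rw [e.right_inv (by rw [F.target_eq e he]; exact mem_univ _)]
    have e₂ : (e (e.symm (p₀.1, τ₂))).2 = τ₂ := by
      rw [e.right_inv (by rw [F.target_eq e he]; exact mem_univ _)]
    rw [e₁, e₂] at key
    exact key hlt

variable {F} in
/-- **On a sub-box, the order of heights is the same in every box containing it** (transversely
oriented atlas). [folklore] -/
theorem IsTransverselyOriented.height_lt_iff_of_subbox (ho : F.IsTransverselyOriented) (he : e ∈ F.atlas)
    (he' : e' ∈ F.atlas) (hsub : subbox e p₀ ρ ⊆ e'.source) (hu : u ∈ subbox e p₀ ρ)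
    (hv : v ∈ subbox e p₀ ρ) : height e' u < height e' v ↔ height e u < height e v := by
  obtain ⟨γ, -, hγm, hγ⟩ := ho.exists_transitionOn he he' hsub
  rw [hγ u hu, hγ v hv]
  exact hγm.lt_iff_lt (F.height_mem_ball_of_mem_subbox he hu) (F.height_mem_ball_of_mem_subbox he hv)

variable {F} in
/-- **On a sub-box, equality of heights is the same in every box containing it** (transversely
oriented atlas). [folklore] -/
theorem IsTransverselyOriented.height_eq_iff_of_subbox (ho : F.IsTransverselyOriented) (he : e ∈ F.atlas)
    (he' : e' ∈ F.atlas) (hsub : subbox e p₀ ρ ⊆ e'.source) (hu : u ∈ subbox e p₀ ρ)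
    (hv : v ∈ subbox e p₀ ρ) : height e' u = height e' v ↔ height e u = height e v := by
  obtain ⟨γ, -, hγm, hγ⟩ := ho.exists_transitionOn he he' hsub
  rw [hγ u hu, hγ v hv]
  exact (hγm.injOn.eq_iff (F.height_mem_ball_of_mem_subbox he hu)
    (F.height_mem_ball_of_mem_subbox he hv))

/-! ## Tameness of heights along curves in a sub-box is box-independent -/

variable {F} in
/-- **The tameness of the height along a curve running in a sub-box does not depend on the
box**: if the `e`-height of `g` is tame on `[a, b]` and `g [a, b] ⊆ subbox e p₀ ρ ⊆ e'.source`,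
then the `e'`-height of `g` is tame on `[a, b]` (it is `γ ∘ (h_e ∘ g)` there, `γ` continuous and
strictly increasing on the height interval). [folklore] -/
theorem IsTransverselyOriented.isTameOn_height_of_subbox (ho : F.IsTransverselyOriented) (he : e ∈ F.atlas)
    (he' : e' ∈ F.atlas) (hsub : subbox e p₀ ρ ⊆ e'.source) {g : ℝ → M} {a b : ℝ}
    (hg : ∀ s ∈ Icc a b, g s ∈ subbox e p₀ ρ)
    (ht : TameFunction.IsTameOn (fun s ↦ height e (g s)) a b) :
    TameFunction.IsTameOn (fun s ↦ height e' (g s)) a b := by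
  obtain ⟨γ, hγc, hγm, hγ⟩ := ho.exists_transitionOn he he' hsub
  -- on `[a, b]` the `e'`-height is `γ ∘ (h_e ∘ g)`
  have heq : EqOn (γ ∘ fun s ↦ height e (g s)) (fun s ↦ height e' (g s)) (Icc a b) :=
    fun s hs ↦ (hγ (g s) (hg s hs)).symm
  refine TameFunction.IsTameOn.congr ?_ heq
  obtain ⟨hc, hR, hL⟩ := ht
  have hball : ∀ s ∈ Icc a b, ball p₀.2 ρ ∈ 𝓝 (height e (g s)) := fun s hs ↦
    isOpen_ball.mem_nhds (F.height_mem_ball_of_mem_subbox he (hg s hs))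
  refine ⟨hγc.comp hc fun s hs ↦ F.height_mem_ball_of_mem_subbox he (hg s hs), fun x hx ↦ ?_,
    fun x hx ↦ ?_⟩
  · have hxab : x ∈ Icc a b := ⟨hx.1, hx.2.le⟩
    exact (hR x hx).comp_of_strictMonoOn ((hc x hxab).mono_of_mem_nhdsWithin
      (mem_nhdsWithin.2 ⟨Iio b, isOpen_Iio, hx.2, fun y hy ↦ ⟨hx.1.trans hy.2, hy.1.le⟩⟩)) (hball x hxab) hγm
  · have hxab : x ∈ Icc a b := ⟨hx.1.le, hx.2⟩
    exact (hL x hx).comp_of_strictMonoOn ((hc x hxab).mono_of_mem_nhdsWithin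
      (mem_nhdsWithin.2 ⟨Ioi a, isOpen_Ioi, hx.1, fun y hy ↦ ⟨hy.1.le, hy.2.trans hx.2⟩⟩)) (hball x hxab) hγm

end Foliation

end Literature.Topology.FourManifolds
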